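import Mathlib
import Literature.Analysis.FunctionSpaces.PeriodicPrimitive
import HarnessLib

/-!
# Leray capping, tools III: the slice-wise row–column antidivergence

Tools file for `stub_lerayCapping` of
`Summit.AnomalousDissipation.AnomalousDissipation.Theses.DyadicWallCascade.DyadicRealisation`
(line Sketch).  For a smooth `g : ℝ³ → ℝ`, `1`-periodic in `Y₀` and `Y₁`, the horizontal field

  `c = (c₀, c₁, 0)`,  `c₀(Y) = ∫₀^{Y₀} g(s,Y₁,Y₂) ds − Y₀ ḡ(Y₁,Y₂)`,
  `c₁(Y) = ∫₀^{Y₁} ḡ(s,Y₂) ds − Y₁ m(Y₂)`,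

with the row average `ḡ(y,t) = ∫₀¹ g(s,y,t) ds` and the slice mean `m(t) = ∫₀¹ ḡ(s,t) ds`, is
smooth (parametric periodic primitives, tree file `PeriodicPrimitive`), `1`-periodic in `Y₀, Y₁`,
vanishes on every horizontal slice on which `g` vanishes, and has divergence `g − m(Y₂)`
(`lerayCapping_corrector`).  No Bogovskiĭ operator and no Fourier analysis are needed.

The file ends with the registered tools stub `stub_lerayCappingTools3`.
-/

open Set Function MeasureTheory intervalIntegral
open scoped BigOperators ContDiff

set_option linter.dupNamespace false

namespace Summit.AnomalousDissipation.AnomalousDissipation.Theorems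

/-- The derivative along `eⱼ` of a differentiable function is the derivative of its restriction to
the coordinate line. [folklore] -/
theorem lerayCapping_fderiv_apply_of_hasDerivAt_line {f : EuclideanSpace ℝ (Fin 3) → ℝ}
    {Y v : EuclideanSpace ℝ (Fin 3)} {d : ℝ} (hf : DifferentiableAt ℝ f Y)
    (hline : HasDerivAt (fun τ : ℝ => f (Y + τ • v)) d 0) : fderiv ℝ f Y v = d := by
  have hℓ : HasDerivAt (fun τ : ℝ => Y + τ • v) v 0 := by
    simpa using ((hasDerivAt_id (0 : ℝ)).smul_const v).const_add Y
  have h1 : HasDerivAt (fun τ : ℝ => f (Y + τ • v)) (fderiv ℝ f Y v) 0 :=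
    hf.hasFDerivAt.comp_hasDerivAt_of_eq 0 hℓ (by simp)
  exact h1.unique hline

/-- **The row–column antidivergence.** For a smooth `g : ℝ³ → ℝ`, `1`-periodic in `Y₀` and `Y₁`,
there is a smooth horizontal field `c = (c₀, c₁, 0)`, `1`-periodic in `Y₀` and `Y₁`, vanishing on
every horizontal plane `{Y₂ = t}` on which `g` vanishes, with
`div c (Y) = g(Y) − ∫₀¹∫₀¹ g(u, s, Y₂) du ds`. [folklore] -/
theorem lerayCapping_corrector (g : EuclideanSpace ℝ (Fin 3) → ℝ)
    (hg : ContDiff ℝ ((⊤ : ℕ∞) : WithTop ℕ∞) g)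
    (hp0 : ∀ Y : EuclideanSpace ℝ (Fin 3), g (Y + EuclideanSpace.single 0 (1 : ℝ)) = g Y)
    (hp1 : ∀ Y : EuclideanSpace ℝ (Fin 3), g (Y + EuclideanSpace.single 1 (1 : ℝ)) = g Y) :
    ∃ c : EuclideanSpace ℝ (Fin 3) → EuclideanSpace ℝ (Fin 3),
      ContDiff ℝ ((⊤ : ℕ∞) : WithTop ℕ∞) c ∧
      (∀ Y : EuclideanSpace ℝ (Fin 3), c (Y + EuclideanSpace.single 0 (1 : ℝ)) = c Y) ∧
      (∀ Y : EuclideanSpace ℝ (Fin 3), c (Y + EuclideanSpace.single 1 (1 : ℝ)) = c Y) ∧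
      (∀ Y : EuclideanSpace ℝ (Fin 3), c Y 2 = 0) ∧
      (∀ Y : EuclideanSpace ℝ (Fin 3),
        ∑ i : Fin 3, (fderiv ℝ c Y (EuclideanSpace.single i (1 : ℝ))) i =
          g Y - ∫ s in (0 : ℝ)..1, ∫ u in (0 : ℝ)..1, g !₂[u, s, Y 2]) ∧
      (∀ t : ℝ, (∀ a b : ℝ, g !₂[a, b, t] = 0) →
        ∀ Y : EuclideanSpace ℝ (Fin 3), Y 2 = t → c Y = 0) := by
  set e0 : EuclideanSpace ℝ (Fin 3) := EuclideanSpace.single 0 (1 : ℝ) with he0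
  set e1 : EuclideanSpace ℝ (Fin 3) := EuclideanSpace.single 1 (1 : ℝ) with he1
  -- points and coordinates
  set pt : ℝ → ℝ → ℝ → EuclideanSpace ℝ (Fin 3) := fun a b t => !₂[a, b, t] with hpt
  have hpt0 : ∀ a b t, pt a b t 0 = a := fun a b t => by simp [hpt]
  have hpt1 : ∀ a b t, pt a b t 1 = b := fun a b t => by simp [hpt]
  have hpt2 : ∀ a b t, pt a b t 2 = t := fun a b t => by simp [hpt]
  have hpt_self : ∀ Y : EuclideanSpace ℝ (Fin 3), pt (Y 0) (Y 1) (Y 2) = Y := by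
    intro Y; ext i; fin_cases i <;> simp [hpt]
  have hpt_e0 : ∀ a b t, pt (a + 1) b t = pt a b t + e0 := by
    intro a b t; ext i; fin_cases i <;> simp [hpt, he0]
  have hpt_e1 : ∀ a b t, pt a (b + 1) t = pt a b t + e1 := by
    intro a b t; ext i; fin_cases i <;> simp [hpt, he1]
  have hpt_smooth : ContDiff ℝ ∞ (fun q : ℝ × ℝ × ℝ => pt q.1 q.2.1 q.2.2) := by
    refine (PiLp.contDiff_toLp (𝕜 := ℝ) (p := 2)).comp (contDiff_pi.2 fun i => ?_)
    fin_cases i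
    · simpa using contDiff_fst
    · simpa using contDiff_snd.fst
    · simpa using contDiff_snd.snd
  have hc0 : ContDiff ℝ ∞ fun Y : EuclideanSpace ℝ (Fin 3) => Y 0 := contDiff_piLp_apply (p := 2)
  have hc1 : ContDiff ℝ ∞ fun Y : EuclideanSpace ℝ (Fin 3) => Y 1 := contDiff_piLp_apply (p := 2)
  have hc2 : ContDiff ℝ ∞ fun Y : EuclideanSpace ℝ (Fin 3) => Y 2 := contDiff_piLp_apply (p := 2)
  -- the integrands `G(s, Y) = g(s, Y₁, Y₂)` and `Ḡ(s, Y) = ∫₀¹ g(u, s, Y₂) du`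
  set G : ℝ × EuclideanSpace ℝ (Fin 3) → ℝ := fun p => g (pt p.1 (p.2 1) (p.2 2)) with hG
  set Gb : ℝ × EuclideanSpace ℝ (Fin 3) → ℝ := fun p => ∫ u in (0 : ℝ)..1, g (pt u p.1 (p.2 2)) with hGb
  have hGs : ContDiff ℝ ∞ G :=
    hg.comp (hpt_smooth.comp (contDiff_fst.prodMk ((hc1.comp contDiff_snd).prodMk (hc2.comp contDiff_snd))))
  have hGbs : ContDiff ℝ ∞ Gb := by
    have h : ContDiff ℝ ∞ fun y : ℝ × (ℝ × EuclideanSpace ℝ (Fin 3)) => g (pt y.1 y.2.1 (y.2.2 2)) :=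
      hg.comp (hpt_smooth.comp (contDiff_fst.prodMk ((contDiff_fst.comp contDiff_snd).prodMk
        (hc2.comp (contDiff_snd.comp contDiff_snd)))))
    exact Literature.Analysis.FunctionSpaces.contDiff_parametric_intervalIntegral
      (H := fun y : ℝ × (ℝ × EuclideanSpace ℝ (Fin 3)) => g (pt y.1 y.2.1 (y.2.2 2))) h 0 1
  have hGc : Continuous G := hGs.continuous
  have hGbc : Continuous Gb := hGbs.continuous
  -- periodicity of the integrands
  have hGper : ∀ s (Y : EuclideanSpace ℝ (Fin 3)), G (s + 1, Y) = G (s, Y) := by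
    intro s Y; simp only [hG, hpt_e0]; exact hp0 _
  have hGbper : ∀ s (Y : EuclideanSpace ℝ (Fin 3)), Gb (s + 1, Y) = Gb (s, Y) := by
    intro s Y
    simp only [hGb]
    refine intervalIntegral.integral_congr fun u _ => ?_
    simp only [hpt_e1]
    exact hp1 _
  -- the periodic primitives
  set H0 : EuclideanSpace ℝ (Fin 3) × ℝ → ℝ := fun x =>
    (∫ s in (0 : ℝ)..x.2, G (s, x.1)) - x.2 * ((1 : ℝ)⁻¹ * ∫ s in (0 : ℝ)..1, G (s, x.1)) with hH0
  set H1 : EuclideanSpace ℝ (Fin 3) × ℝ → ℝ := fun x =>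
    (∫ s in (0 : ℝ)..x.2, Gb (s, x.1)) - x.2 * ((1 : ℝ)⁻¹ * ∫ s in (0 : ℝ)..1, Gb (s, x.1)) with hH1
  have hH0s : ContDiff ℝ ∞ H0 := Literature.Analysis.FunctionSpaces.contDiff_periodicPrimitive hGs 1
  have hH1s : ContDiff ℝ ∞ H1 := Literature.Analysis.FunctionSpaces.contDiff_periodicPrimitive hGbs 1
  set c0 : EuclideanSpace ℝ (Fin 3) → ℝ := fun Y => H0 (Y, Y 0) with hc0d
  set c1 : EuclideanSpace ℝ (Fin 3) → ℝ := fun Y => H1 (Y, Y 1) with hc1d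
  have hc0s : ContDiff ℝ ∞ c0 := hH0s.comp (contDiff_id.prodMk hc0)
  have hc1s : ContDiff ℝ ∞ c1 := hH1s.comp (contDiff_id.prodMk hc1)
  -- dependence of the integrands on the parameter
  have hG_dep : ∀ s (Y Z : EuclideanSpace ℝ (Fin 3)), Y 1 = Z 1 → Y 2 = Z 2 → G (s, Y) = G (s, Z) := by
    intro s Y Z h1 h2; simp only [hG, h1, h2]
  have hGb_dep : ∀ s (Y Z : EuclideanSpace ℝ (Fin 3)), Y 2 = Z 2 → Gb (s, Y) = Gb (s, Z) := by
    intro s Y Z h2; simp only [hGb, h2]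
  have hH0_dep : ∀ (Y Z : EuclideanSpace ℝ (Fin 3)) (r : ℝ), Y 1 = Z 1 → Y 2 = Z 2 →
      H0 (Y, r) = H0 (Z, r) := by
    intro Y Z r h1 h2
    simp only [hH0, hG_dep _ Y Z h1 h2]
  have hH1_dep : ∀ (Y Z : EuclideanSpace ℝ (Fin 3)) (r : ℝ), Y 2 = Z 2 → H1 (Y, r) = H1 (Z, r) := by
    intro Y Z r h2
    simp only [hH1, hGb_dep _ Y Z h2]
  have hG_e1 : ∀ s (Y : EuclideanSpace ℝ (Fin 3)), G (s, Y + e1) = G (s, Y) := by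
    intro s Y
    simp only [hG]
    have : pt s ((Y + e1) 1) ((Y + e1) 2) = pt s (Y 1) (Y 2) + e1 := by
      ext i; fin_cases i <;> simp [hpt, he1]
    rw [this]
    exact hp1 _
  have hH0_e1 : ∀ (Y : EuclideanSpace ℝ (Fin 3)) (r : ℝ), H0 (Y + e1, r) = H0 (Y, r) := by
    intro Y r
    simp only [hH0, hG_e1]
  -- the field
  refine ⟨fun Y => c0 Y • e0 + c1 Y • e1, (hc0s.smul contDiff_const).add (hc1s.smul contDiff_const),
    fun Y => ?_, fun Y => ?_, fun Y => ?_, fun Y => ?_, fun t ht Y hY => ?_⟩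
  · -- periodicity in `Y₀`
    have h0 : c0 (Y + e0) = c0 Y := by
      simp only [hc0d]
      rw [hH0_dep (Y + e0) Y _ (by simp [he0]) (by simp [he0])]
      have : (Y + e0) 0 = Y 0 + 1 := by simp [he0]
      rw [this]
      exact Literature.Analysis.FunctionSpaces.periodicPrimitive_add_period hGc one_ne_zero
        (fun s => hGper s Y) (Y 0)
    have h1 : c1 (Y + e0) = c1 Y := by
      simp only [hc1d]
      rw [hH1_dep (Y + e0) Y _ (by simp [he0])]
      simp [he0]
    simp only [h0, h1]
  · -- periodicity in `Y₁`
    have h0 : c0 (Y + e1) = c0 Y := by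
      simp only [hc0d]
      rw [hH0_e1]
      simp [he1]
    have h1 : c1 (Y + e1) = c1 Y := by
      simp only [hc1d]
      rw [hH1_dep (Y + e1) Y _ (by simp [he1])]
      have : (Y + e1) 1 = Y 1 + 1 := by simp [he1]
      rw [this]
      exact Literature.Analysis.FunctionSpaces.periodicPrimitive_add_period hGbc one_ne_zero
        (fun s => hGbper s Y) (Y 1)
    simp only [h0, h1]
  · -- the third component
    show (c0 Y • e0 + c1 Y • e1) 2 = 0
    simp [he0, he1]
  · -- the divergence
    have hd : HasFDerivAt (fun Y => c0 Y • e0 + c1 Y • e1)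
        ((fderiv ℝ c0 Y).smulRight e0 + (fderiv ℝ c1 Y).smulRight e1) Y :=
      ((hc0s.differentiable (by simp) Y).hasFDerivAt.smul_const e0).add
        ((hc1s.differentiable (by simp) Y).hasFDerivAt.smul_const e1)
    rw [hd.fderiv]
    -- the four directional derivatives
    have hd00 : fderiv ℝ c0 Y e0 = G (Y 0, Y) - ∫ s in (0 : ℝ)..1, G (s, Y) := by
      refine lerayCapping_fderiv_apply_of_hasDerivAt_line (hc0s.differentiable (by simp) Y) ?_
      have heq : (fun τ : ℝ => c0 (Y + τ • e0)) = fun τ => H0 (Y, Y 0 + τ) := by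
        funext τ
        simp only [hc0d]
        rw [hH0_dep (Y + τ • e0) Y _ (by simp [he0]) (by simp [he0])]
        simp [he0]
      rw [heq]
      have h := (Literature.Analysis.FunctionSpaces.hasDerivAt_periodicPrimitive hGc 1 Y
        (Y 0 + 0)).comp_const_add (Y 0) 0
      simpa [hH0] using h
    have hd10 : fderiv ℝ c1 Y e0 = 0 := by
      refine lerayCapping_fderiv_apply_of_hasDerivAt_line (hc1s.differentiable (by simp) Y) ?_
      have heq : (fun τ : ℝ => c1 (Y + τ • e0)) = fun _ => H1 (Y, Y 1) := by
        funext τ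
        simp only [hc1d]
        rw [hH1_dep (Y + τ • e0) Y _ (by simp [he0])]
        simp [he0]
      rw [heq]
      exact hasDerivAt_const _ _
    have hd11 : fderiv ℝ c1 Y e1 = Gb (Y 1, Y) - ∫ s in (0 : ℝ)..1, Gb (s, Y) := by
      refine lerayCapping_fderiv_apply_of_hasDerivAt_line (hc1s.differentiable (by simp) Y) ?_
      have heq : (fun τ : ℝ => c1 (Y + τ • e1)) = fun τ => H1 (Y, Y 1 + τ) := by
        funext τ
        simp only [hc1d]
        rw [hH1_dep (Y + τ • e1) Y _ (by simp [he1])]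
        simp [he1]
      rw [heq]
      have h := (Literature.Analysis.FunctionSpaces.hasDerivAt_periodicPrimitive hGbc 1 Y
        (Y 1 + 0)).comp_const_add (Y 1) 0
      simpa [hH1] using h
    have hGY : G (Y 0, Y) = g Y := by simp only [hG]; rw [hpt_self]
    have hGbY : Gb (Y 1, Y) = ∫ s in (0 : ℝ)..1, G (s, Y) := by simp only [hGb, hG]
    rw [Fin.sum_univ_three]
    simp only [_root_.add_apply, ContinuousLinearMap.smulRight_apply, PiLp.add_apply,
      PiLp.smul_apply, smul_eq_mul]
    rw [← he0, ← he1, hd00, hd10, hd11, hGY, hGbY]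
    have h2e0 : e0 2 = 0 := by simp [he0]
    have h2e1 : e1 2 = 0 := by simp [he1]
    have h0e0 : e0 0 = 1 := by simp [he0]
    have h0e1 : e1 0 = 0 := by simp [he1]
    have h1e0 : e0 1 = 0 := by simp [he0]
    have h1e1 : e1 1 = 1 := by simp [he1]
    rw [h2e0, h2e1, h0e0, h0e1, h1e0, h1e1]
    simp only [hGb, hG, hpt]
    ring
  · -- vanishing on slices
    have hG0 : ∀ s, G (s, Y) = 0 := fun s => by simp only [hG, hY]; exact ht _ _
    have hGb0 : ∀ s, Gb (s, Y) = 0 := fun s => by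
      simp only [hGb, hY, hpt, ht, intervalIntegral.integral_zero]
    have h0 : c0 Y = 0 := by simp [hc0d, hH0, hG0]
    have h1 : c1 Y = 0 := by simp [hc1d, hH1, hGb0]
    simp [h0, h1]

/-- Registered tools stub of `stub_lerayCapping` (line Sketch of crux `DyadicRealisation`): the
conjunction of the lemmas of this file. [folklore] -/
theorem stub_lerayCappingTools3 :
    (∀ {f : EuclideanSpace ℝ (Fin 3) → ℝ} {Y v : EuclideanSpace ℝ (Fin 3)} {d : ℝ},
      DifferentiableAt ℝ f Y → HasDerivAt (fun τ : ℝ => f (Y + τ • v)) d 0 → fderiv ℝ f Y v = d) ∧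
    (∀ g : EuclideanSpace ℝ (Fin 3) → ℝ, ContDiff ℝ ((⊤ : ℕ∞) : WithTop ℕ∞) g →
      (∀ Y : EuclideanSpace ℝ (Fin 3), g (Y + EuclideanSpace.single 0 (1 : ℝ)) = g Y) →
      (∀ Y : EuclideanSpace ℝ (Fin 3), g (Y + EuclideanSpace.single 1 (1 : ℝ)) = g Y) →
      ∃ c : EuclideanSpace ℝ (Fin 3) → EuclideanSpace ℝ (Fin 3),
        ContDiff ℝ ((⊤ : ℕ∞) : WithTop ℕ∞) c ∧
        (∀ Y : EuclideanSpace ℝ (Fin 3), c (Y + EuclideanSpace.single 0 (1 : ℝ)) = c Y) ∧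
        (∀ Y : EuclideanSpace ℝ (Fin 3), c (Y + EuclideanSpace.single 1 (1 : ℝ)) = c Y) ∧
        (∀ Y : EuclideanSpace ℝ (Fin 3), c Y 2 = 0) ∧
        (∀ Y : EuclideanSpace ℝ (Fin 3),
          ∑ i : Fin 3, (fderiv ℝ c Y (EuclideanSpace.single i (1 : ℝ))) i =
            g Y - ∫ s in (0 : ℝ)..1, ∫ u in (0 : ℝ)..1, g !₂[u, s, Y 2]) ∧
        (∀ t : ℝ, (∀ a b : ℝ, g !₂[a, b, t] = 0) →
          ∀ Y : EuclideanSpace ℝ (Fin 3), Y 2 = t → c Y = 0)) :=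
  ⟨fun hf hline => lerayCapping_fderiv_apply_of_hasDerivAt_line hf hline, lerayCapping_corrector⟩

end Summit.AnomalousDissipation.AnomalousDissipation.Theorems
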